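import Literature.AlgebraicGeometry.Morphisms.PrincipalAffineCoverRefinement
import HarnessLib

/-!
# A common principal affine refinement of two affine covers BY BASIC OPENS of their members

Topic `Literature/AlgebraicGeometry/Morphisms`; THEOREMS only (no definition, no named fact, no instance), Mathlib only.
Sequel of ★ `Morphisms/PrincipalAffineCoverRefinement` (a principal affine cover `(U, b)`, `U j ∩ U l = D(b_{jl})`, refines
to a principal affine cover subordinate to any open cover).  Here the refinement is required to consist of BASIC OPENS of
members of BOTH given covers: for a principal affine cover `(U, b)` and a second cover `U′` by affine opens, there is a
(finite, on a quasi-compact scheme) principal affine cover `W s = D(a_s) = D(a′_s)` with `a_s ∈ Γ(X, U_{τ s})` and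
`a′_s ∈ Γ(X, U′_{τ′ s})` (THE PRINT: inside an affine open the principal opens form a basis, and a principal open of a
principal open of an affine `V` is a principal open of `V` — [Hartshorne1977] II Prop. 2.2, Ex. 2.16 (a); [StacksProject]
Tags 01IQ–01IS; Mathlib `IsAffineOpen.exists_basicOpen_le`, `IsAffineOpen.basicOpen_basicOpen_is_basicOpen`): at a point
`x ∈ U_j ∩ U′_i` take `x ∈ D_{U′_i}(h) ⊆ U_j`, then `x ∈ D_{U_j}(g) ⊆ D(h)`; `D(g) = D_{D(h)}(g|)` is a principal open of
`U′_i` as well, and `D(g_x) ∩ D(g_y) = D(g_x · f)` exactly as in the ★ file.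

* `exists_principal_affine_cover_basicOpen_refinement₂` — pointwise form (indexed by the points of `X`);
* **`exists_finite_principal_affine_cover_basicOpen_refinement₂`** — finite form on a quasi-compact scheme.

This is the shape in which two systems of lifted gluing data on `U` and on `U′ = f⁻¹U` are RESTRICTED to one common cover
(★ `Deformation/SmoothSchemeLiftObstructionLocalize`: restriction of lifted automorphisms exists along principal opens
`D(a) ⊆ U_j` only).  Cell hodgecm-mathlib (D-0151), F-11 α1 / J4-(iv) slots (4)/(6) (second hand B-p16 (g19) under
F0P1a-p04 (g2)); HC_CM is proved only modulo the 7 printed citations until rung 0 closes — nothing here bears on it.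

## References
* [Hartshorne1977] R. Hartshorne, *Algebraic Geometry*, GTM 52 (1977), II Prop. 2.2, Ex. 2.16 (a).
* [StacksProject] The Stacks Project, Tags 01IQ, 01IS (standard opens form a basis; `D(f) ∩ D(g) = D(fg)`), Tag 01K4.
-/

noncomputable section

universe u

open CategoryTheory AlgebraicGeometry TopologicalSpace Opposite

namespace Literature.AlgebraicGeometry.Morphisms

variable {X : Scheme.{u}}

/-- **Common principal affine refinement by basic opens (pointwise form).**  For a principal affine cover `(U, b)`
(`U j ∩ U l = D(b_{jl})`) and a cover `U′` by affine opens there are, for every point `x`, indices `τ x`, `τ′ x` and functions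
`a x ∈ Γ(X, U_{τ x})`, `a′ x ∈ Γ(X, U′_{τ′ x})` with `x ∈ V x := D(a x) = D(a′ x)`, the `V x` forming a PRINCIPAL affine cover
(`V x ∩ V y = D(c x y)`). [cite: Hartshorne1977, II Prop. 2.2 and Ex. 2.16 (a)] [cite: StacksProject, Tag 01IS] -/
theorem exists_principal_affine_cover_basicOpen_refinement₂ {ι ι' : Type*} (U : ι → X.affineOpens)
    (b : (j l : ι) → Γ(X, (U j).1)) (hb : ∀ j l, (U j).1 ⊓ (U l).1 = X.basicOpen (b j l))
    (hU : ⨆ j, (U j).1 = ⊤) (U' : ι' → X.affineOpens) (hU' : ⨆ i, (U' i).1 = ⊤) :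
    ∃ (V : X → X.affineOpens) (c : (x y : X) → Γ(X, (V x).1)) (τ : X → ι) (τ' : X → ι')
      (a : (x : X) → Γ(X, (U (τ x)).1)) (a' : (x : X) → Γ(X, (U' (τ' x)).1)),
      (∀ x, x ∈ (V x).1) ∧ (⨆ x, (V x).1 = ⊤) ∧ (∀ x y, (V x).1 ⊓ (V y).1 = X.basicOpen (c x y)) ∧
      (∀ x, (V x).1 = X.basicOpen (a x)) ∧ (∀ x, (V x).1 = X.basicOpen (a' x)) := by
  -- at `x ∈ U_j ∩ U′_i`: `x ∈ D_{U′_i}(h) ⊆ U_j`, then `x ∈ D_{U_j}(g) ⊆ D(h)`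
  have hpt : ∀ x : X, ∃ (j : ι) (i : ι') (h : Γ(X, (U' i).1)) (g : Γ(X, (U j).1)),
      X.basicOpen h ≤ (U j).1 ∧ X.basicOpen g ≤ X.basicOpen h ∧ x ∈ X.basicOpen g := fun x => by
    obtain ⟨j, hj⟩ := Opens.mem_iSup.mp (hU.ge (Set.mem_univ x) : x ∈ ⨆ j, (U j).1)
    obtain ⟨i, hi⟩ := Opens.mem_iSup.mp (hU'.ge (Set.mem_univ x) : x ∈ ⨆ i, (U' i).1)
    obtain ⟨h, hhU, hxh⟩ := (U' i).2.exists_basicOpen_le ⟨x, hj⟩ hi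
    obtain ⟨g, hgh, hxg⟩ := (U j).2.exists_basicOpen_le ⟨x, hxh⟩ hj
    exact ⟨j, i, h, g, hhU, hgh, hxg⟩
  choose j i h g hhU hgh hxg using hpt
  -- `D(g_x)` is a principal open of `U′_{i x}`: `D(g_x) = D_{D(h_x)}(g_x|) = D_{U′}(a′)`
  have ha' : ∀ x, ∃ f' : Γ(X, (U' (i x)).1), X.basicOpen f' = X.basicOpen (g x) := fun x => by
    obtain ⟨f', hf'⟩ := (U' (i x)).2.basicOpen_basicOpen_is_basicOpen (h x)
      (X.presheaf.map (homOfLE (hhU x)).op (g x))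
    refine ⟨f', ?_⟩
    rw [hf', Scheme.basicOpen_res]
    exact inf_eq_right.mpr (hgh x)
  choose a' ha' using ha'
  -- on `U_{j(x)}`: `U_{j(x)} ∩ U_{j(y)} ∩ D(g_y)` is a principal open `D(f x y)`
  have hle : ∀ x y, X.basicOpen (b (j x) (j y)) ≤ (U (j y)).1 := fun x y => by
    rw [← hb]
    exact inf_le_right
  have hf : ∀ x y, ∃ f : Γ(X, (U (j x)).1),
      X.basicOpen f = X.basicOpen (X.presheaf.map (homOfLE (hle x y)).op (g y)) := fun x y =>
    (U (j x)).2.basicOpen_basicOpen_is_basicOpen (b (j x) (j y)) _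
  choose f hf using hf
  refine ⟨fun x => ⟨X.basicOpen (g x), (U (j x)).2.basicOpen _⟩,
    fun x y => X.presheaf.map (homOfLE (X.basicOpen_le (g x))).op (g x * f x y), j, i, g, a',
    hxg, ?_, fun x y => ?_, fun x => rfl, fun x => (ha' x).symm⟩
  · exact top_le_iff.mp fun x _ => Opens.mem_iSup.mpr ⟨x, hxg x⟩
  · -- `D(g_x) ∩ D(g_y) = D(g_x · f)` with `D(f) = U_{j(x)} ∩ U_{j(y)} ∩ D(g_y)`
    change X.basicOpen (g x) ⊓ X.basicOpen (g y) = _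
    have e1 : X.basicOpen (g x) ⊓ (U (j x)).1 = X.basicOpen (g x) := inf_eq_left.mpr (X.basicOpen_le _)
    have e2 : (U (j y)).1 ⊓ X.basicOpen (g y) = X.basicOpen (g y) := inf_eq_right.mpr (X.basicOpen_le _)
    rw [Scheme.basicOpen_res, Scheme.basicOpen_mul, ← inf_assoc, inf_idem, hf, Scheme.basicOpen_res, ← hb]
    calc X.basicOpen (g x) ⊓ X.basicOpen (g y)
        = (X.basicOpen (g x) ⊓ (U (j x)).1) ⊓ ((U (j y)).1 ⊓ X.basicOpen (g y)) := by rw [e1, e2]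
      _ = X.basicOpen (g x) ⊓ ((U (j x)).1 ⊓ (U (j y)).1 ⊓ X.basicOpen (g y)) := by ac_rfl

/-- **On a quasi-compact scheme: a FINITE principal affine cover by common basic opens of two affine covers** (the first
principal).  Output: a finite index type `T`, `V : T → X.affineOpens` with `⨆ V = ⊤`, `V s ∩ V t = D(c s t)`, and
`τ τ′ a a′` with `V s = D(a s) = D(a′ s)`, `a s ∈ Γ(X, U_{τ s})`, `a′ s ∈ Γ(X, U′_{τ′ s})` — in particular `V s ≤ U (τ s)` and
`V s ≤ U′ (τ′ s)`. [cite: StacksProject, Tag 01K4] [cite: Hartshorne1977, II Ex. 2.16 (a)] -/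
theorem exists_finite_principal_affine_cover_basicOpen_refinement₂ [CompactSpace X] {ι ι' : Type*}
    (U : ι → X.affineOpens) (b : (j l : ι) → Γ(X, (U j).1)) (hb : ∀ j l, (U j).1 ⊓ (U l).1 = X.basicOpen (b j l))
    (hU : ⨆ j, (U j).1 = ⊤) (U' : ι' → X.affineOpens) (hU' : ⨆ i, (U' i).1 = ⊤) :
    ∃ (T : Type u) (_ : Finite T) (V : T → X.affineOpens) (c : (s t : T) → Γ(X, (V s).1)) (τ : T → ι) (τ' : T → ι')
      (a : (s : T) → Γ(X, (U (τ s)).1)) (a' : (s : T) → Γ(X, (U' (τ' s)).1)),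
      (⨆ s, (V s).1 = ⊤) ∧ (∀ s t, (V s).1 ⊓ (V t).1 = X.basicOpen (c s t)) ∧
      (∀ s, (V s).1 = X.basicOpen (a s)) ∧ (∀ s, (V s).1 = X.basicOpen (a' s)) := by
  obtain ⟨V, c, τ, τ', a, a', hxV, -, hc, hVa, hVa'⟩ :=
    exists_principal_affine_cover_basicOpen_refinement₂ U b hb hU U' hU'
  obtain ⟨t, ht⟩ := isCompact_univ.elim_finite_subcover (fun x : X => ((V x).1 : Set X))
    (fun x => (V x).1.2) fun x _ => Set.mem_iUnion.mpr ⟨x, hxV x⟩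
  refine ⟨↥t, inferInstance, fun s => V s.1, fun s s' => c s.1 s'.1, fun s => τ s.1, fun s => τ' s.1,
    fun s => a s.1, fun s => a' s.1, ?_, fun s s' => hc s.1 s'.1, fun s => hVa s.1, fun s => hVa' s.1⟩
  refine top_le_iff.mp fun x _ => ?_
  obtain ⟨y, hy, hxy⟩ := Set.mem_iUnion₂.mp (ht (Set.mem_univ x))
  exact Opens.mem_iSup.mpr ⟨⟨y, hy⟩, hxy⟩

end Literature.AlgebraicGeometry.Morphisms

end
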